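import Literature.Computability.Complexity.PaulPippengerSzemerediTrotter1983Formats
import Literature.Computability.Complexity.PaulPippengerSzemerediTrotter1983Quantifiers
import HarnessLib

/-!
# The verifier's acceptance predicate and the soundness of the `Σ₄` protocol (PPST 1983, §3)

Literature / complexity toolkit, eighteenth brick of the inline formalization of
Paul–Pippenger–Szemerédi–Trotter 1983 (`PaulPippengerSzemerediTrotter1983.lean`, fact
`PaulEtAl1983_NTIME_not_subset_DTIME`; roadmap Layer 4, assembly, part 3). The acceptance
predicate of the linear-time verifier on `⟨⟨⟨⟨x, y₁⟩, y₂⟩, y₃⟩, y₄⟩` — the POLARITY LADDER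
(`y₁` undecodable: reject; `y₂` not a branch index `≤ N`: accept; `y₃` undecodable or with an
index `> N`: reject; `y₄` not a descriptor: accept; otherwise the one selected check of
`…Spec.lean`) —, its language `Vlang`, the unfolding of `QSigma 4` (`…Quantifiers.lean`) into
`∃ y₁ ∀ y₂ ∃ y₃ ∀ y₄`, and the SOUNDNESS half of the protocol: if `x` has a `Σ₄` witness then
the packaged flat program, run from the input configuration of `x`, reaches the accepting
counter `acc` (`protocol_sound` of `…Protocol.lean`, `allChecks_sound` of `…Spec.lean`,
`FlatN.run_cfgN` of `…Flat.lean`). Also the congruence lemmas (claims that agree on light data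
and on the consulted heavy data pass the same checks) used by the completeness half.

* `PPSTSpec.Accepts`, `PPSTSpec.Vlang`, `mem_Vlang_iff`, `qSigma_four_iff`;
* `length_le_of_recsP`, `recs_length_le_of_decY1` (`6 (N + 1) ≤ |y₁|`), `length_encQ_le`;
* **`PPSTSpec.sound`**: `QSigma 4 c |x| Vlang x → ∃ s, (P.step^[s] ⟨0, input x⟩).pc = acc`
  (for `3K + 36 ≤ c`, `acc < |P|`);
* `length_le_of_egP`, `length_le_of_groups'`, `length_le_of_entryP`, `length_le_of_entriesP`,
  `entries_length_le_of_decY3` (a decodable `y₃` has at most `|y₃| / 16` entries).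

No named fact is introduced (definitions with bodies and theorems only).

## References

* W. J. Paul, N. Pippenger, E. Szemerédi, W. T. Trotter, *On determinism versus non-determinism
  and related problems*, FOCS 1983, 429–438, §3 [PaulEtAl1983].
-/

namespace Literature.Computability.Complexity

open Turing Function _root_.Computability TM2Blocks

-- The `constructorNameAsVariable` linter puts binder types in weak head normal form; on
-- hypotheses `w ∈ Vlang …` with `w` a concrete pairing this unfolds the decoders and times out.
set_option linter.constructorNameAsVariable false

namespace PPSTSpec

variable {K : ℕ} (P : AProg Bool (Fin K)) (hP : 0 < P.length) (inp out : Fin K) (acc : ℕ)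

/-! ### The acceptance predicate and its language -/

/-- The last rung: the selected check, or accept on a non-descriptor. [folklore] -/
def Ladder₄ (x : List Bool) (D : Y1 K) (j : ℕ) (E : Y3 K) : Option (Q K) → Prop
  | none => True
  | some q => Check P hP inp out acc x D j E q

/-- Third rung: `y₃` must decode when the branch index is in range. [folklore] -/
def Ladder₃ (x : List Bool) (D : Y1 K) (j : ℕ) : Option (Y3 K) → Option (Q K) → Prop
  | none, _ => ¬ j ≤ lastBlock D
  | some E, oq => j ≤ lastBlock D → Ladder₄ P hP inp out acc x D j E oq

/-- Second rung: accept on a non-index. [folklore] -/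
def Ladder₂ (x : List Bool) (D : Y1 K) : Option ℕ → Option (Y3 K) → Option (Q K) → Prop
  | none, _, _ => True
  | some j, oE, oq => Ladder₃ P hP inp out acc x D j oE oq

/-- **The polarity ladder** on the four decoded values: `y₁` undecodable — reject; `y₂` not a
branch index — accept; branch index beyond the last block — accept; `y₃` undecodable — reject;
entries beyond the last block — reject; `y₄` not a descriptor — accept; otherwise the selected
check. [cite: PaulEtAl1983, §3] -/
def Ladder (x : List Bool) : Option (Y1 K) → Option ℕ → Option (Y3 K) → Option (Q K) → Prop
  | none, _, _, _ => False
  | some D, oj, oE, oq => Ladder₂ P hP inp out acc x D oj oE oq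

section LadderLemmas

variable (x : List Bool) (D : Y1 K) (j : ℕ) (E : Y3 K) (q : Q K) (oj : Option ℕ) (oE : Option (Y3 K))
  (oq : Option (Q K))

/-- Rung equations. [folklore] -/
@[simp] theorem ladder_none : Ladder P hP inp out acc x none oj oE oq = False := rfl
/-- Rung equations. [folklore] -/
@[simp] theorem ladder_some_none : Ladder P hP inp out acc x (some D) none oE oq = True := rfl
/-- Rung equations. [folklore] -/
@[simp] theorem ladder_some_some_none :
    Ladder P hP inp out acc x (some D) (some j) none oq = ¬ j ≤ lastBlock D := rfl
/-- Rung equations. [folklore] -/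
@[simp] theorem ladder_some_some_some_none :
    Ladder P hP inp out acc x (some D) (some j) (some E) none = (j ≤ lastBlock D → True) := rfl
/-- Rung equations. [folklore] -/
@[simp] theorem ladder_some_some_some_some :
    Ladder P hP inp out acc x (some D) (some j) (some E) (some q) =
      (j ≤ lastBlock D → Check P hP inp out acc x D j E q) := rfl

end LadderLemmas

/-- **The verifier's acceptance predicate.** [cite: PaulEtAl1983, §3] -/
def Accepts (x y₁ y₂ y₃ y₄ : List Bool) : Prop :=
  Ladder P hP inp out acc x (decY1 K y₁) (decJ y₂) (decY3 K y₃) (decQ K y₄)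

/-- **The verifier's language**: words `⟨⟨⟨⟨x, y₁⟩, y₂⟩, y₃⟩, y₄⟩` that are accepted. The five
components are read off a word exactly as the machine's pair reader `Com.prs` reads them — first
components by `(boolUnpair ·).1`, remainders by `readRest` — which agrees with `boolUnpair` on
well-formed pairings (`mem_Vlang_iff`). [folklore] -/
def Vlang : Language Bool :=
  {w | Accepts P hP inp out acc (boolUnpair (boolUnpair (boolUnpair (boolUnpair w).1).1).1).1
    (PairFstTM.readRest (boolUnpair (boolUnpair (boolUnpair w).1).1).1)
    (PairFstTM.readRest (boolUnpair (boolUnpair w).1).1)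
    (PairFstTM.readRest (boolUnpair w).1) (PairFstTM.readRest w)}

/-- Membership in the verifier's language (definitional). [folklore] -/
theorem mem_Vlang_iff' (w : List Bool) :
    w ∈ Vlang P hP inp out acc ↔
      Accepts P hP inp out acc (boolUnpair (boolUnpair (boolUnpair (boolUnpair w).1).1).1).1
        (PairFstTM.readRest (boolUnpair (boolUnpair (boolUnpair w).1).1).1)
        (PairFstTM.readRest (boolUnpair (boolUnpair w).1).1)
        (PairFstTM.readRest (boolUnpair w).1) (PairFstTM.readRest w) :=
  Iff.rfl

/-- Membership of a quadruple pairing. [folklore] -/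
theorem mem_Vlang_iff (x y₁ y₂ y₃ y₄ : List Bool) :
    boolPair (boolPair (boolPair (boolPair x y₁) y₂) y₃) y₄ ∈ Vlang P hP inp out acc ↔
      Accepts P hP inp out acc x y₁ y₂ y₃ y₄ := by
  rw [mem_Vlang_iff']
  simp only [boolUnpair_boolPair, readRest_boolPair]

/-- **`QSigma 4` unfolded**: `∃ y₁ ∀ y₂ ∃ y₃ ∀ y₄`. [folklore] -/
theorem qSigma_four_iff (c n : ℕ) (V : Language Bool) (x : List Bool) :
    QSigma 4 c n V x ↔ ∃ y₁ : List Bool, y₁.length ≤ c * n + c ∧ ∀ y₂ : List Bool, y₂.length ≤ c * n + c →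
      ∃ y₃ : List Bool, y₃.length ≤ c * n + c ∧ ∀ y₄ : List Bool, y₄.length ≤ c * n + c →
        boolPair (boolPair (boolPair (boolPair x y₁) y₂) y₃) y₄ ∈ V := by
  simp only [QSigma, compl_compl]
  push Not
  exact Iff.rfl

/-! ### Size bookkeeping of the decoders -/

/-- A parsed field does not lengthen the stream. [folklore] -/
theorem length_le_of_field {ts : List Tok} {w : List Bool} {ts' : List Tok} (h : field ts = some (w, ts')) :
    ts'.length + 1 ≤ ts.length := by
  induction ts generalizing w ts' with
  | nil => simp [field] at h
  | cons t ts ih =>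
    cases t with
    | bit d =>
      simp only [field, Option.map_eq_some_iff, Prod.exists, Prod.mk.injEq] at h
      obtain ⟨w', ts'', h1, rfl, rfl⟩ := h
      have := ih h1
      simp; omega
    | sep =>
      simp only [field, Option.some.injEq, Prod.mk.injEq] at h
      obtain ⟨rfl, rfl⟩ := h
      simp
    | stop => simp [field] at h

/-- Parsed groups do not lengthen the stream. [folklore] -/
theorem length_le_of_groups {α : Type} {p : List Tok → Option (α × List Tok)}
    (hp : ∀ ts a ts', p ts = some (a, ts') → ts'.length ≤ ts.length) :
    ∀ (n : ℕ) (ts : List Tok) (as : List α) (ts' : List Tok), groups p n ts = some (as, ts') →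
      ts'.length ≤ ts.length
  | 0, ts, as, ts', h => by simp [groups] at h; rw [h.2]
  | n + 1, ts, as, ts', h => by
    simp only [groups, Option.bind_eq_bind, Option.bind_eq_some_iff, Prod.exists] at h
    obtain ⟨a, ts₁, h1, as', ts₂, h2, h3⟩ := h
    simp only [Option.some.injEq, Prod.mk.injEq] at h3
    obtain ⟨rfl, rfl⟩ := h3
    exact (length_le_of_groups hp n ts₁ as' ts₂ h2).trans (hp _ _ _ h1)

/-- `numsP` does not lengthen the stream. [folklore] -/
theorem length_le_of_numsP (ts : List Tok) (g : Nums) (ts' : List Tok) (h : numsP ts = some (g, ts')) :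
    ts'.length ≤ ts.length := by
  simp only [numsP, Option.bind_eq_bind, Option.bind_eq_some_iff, Prod.exists, Option.some.injEq,
    Prod.mk.injEq] at h
  obtain ⟨w₁, t₁, h₁, w₂, t₂, h₂, w₃, t₃, h₃, w₄, t₄, h₄, w₅, t₅, h₅, w₆, t₆, h₆, w₇, t₇, h₇, -, rfl⟩ := h
  have := length_le_of_field h₁; have := length_le_of_field h₂; have := length_le_of_field h₃
  have := length_le_of_field h₄; have := length_le_of_field h₅; have := length_le_of_field h₆
  have := length_le_of_field h₇; omega

/-- `hvP` does not lengthen the stream. [folklore] -/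
theorem length_le_of_hvP (ts : List Tok) (g : Hv) (ts' : List Tok) (h : hvP ts = some (g, ts')) :
    ts'.length ≤ ts.length := by
  simp only [hvP, Option.bind_eq_bind, Option.bind_eq_some_iff, Prod.exists, Option.some.injEq,
    Prod.mk.injEq] at h
  obtain ⟨w₁, t₁, h₁, w₂, t₂, h₂, -, rfl⟩ := h
  have := length_le_of_field h₁; have := length_le_of_field h₂; omega

/-- A parsed record consumes at least three tokens. [folklore] -/
theorem length_le_of_recP {ts : List Tok} {r : Rec K} {ts' : List Tok} (h : recP K ts = some (r, ts')) :
    ts'.length + 3 ≤ ts.length := by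
  simp only [recP, Option.bind_eq_bind, Option.bind_eq_some_iff, Prod.exists] at h
  obtain ⟨pcw, t₁, h₁, ns, t₂, h₂, jb, t₃, h₃, hs, t₄, h₄, h₅⟩ := h
  have e₁ := length_le_of_field h₁
  have e₂ := length_le_of_groups length_le_of_numsP K t₁ ns t₂ h₂
  have e₃ := length_le_of_field h₃
  have e₄ := length_le_of_groups length_le_of_hvP K t₃ hs t₄ h₄
  split at h₅
  · simp only [Option.some.injEq, Prod.mk.injEq] at h₅
    obtain ⟨-, rfl⟩ := h₅
    simp at e₄ ⊢; omega
  · simp at h₅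

/-- Parsed record lists: three tokens per record. [folklore] -/
theorem length_le_of_recsP : ∀ (n : ℕ) (ts : List Tok) (rs : List (Rec K)),
    recsP K n ts = some rs → 3 * rs.length ≤ ts.length
  | n, [], rs, h => by
    cases n <;> simp [recsP] at h <;> subst h <;> simp
  | 0, _ :: _, rs, h => by simp [recsP] at h
  | n + 1, t :: ts, rs, h => by
    simp only [recsP, Option.bind_eq_bind, Option.bind_eq_some_iff, Prod.exists] at h
    obtain ⟨r, ts', h1, rs', h2, h3⟩ := h
    simp only [Option.some.injEq] at h3
    subst h3
    have e1 := length_le_of_recP h1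
    have e2 := length_le_of_recsP n ts' rs' h2
    simp only [List.length_cons] at e1 ⊢
    omega

/-- Tokenizing halves the length. [folklore] -/
theorem length_of_toks : ∀ (w : List Bool) (ts : List Tok), toks w = some ts → w.length = 2 * ts.length
  | [], ts, h => by simp [toks] at h; subst h; rfl
  | [_], ts, h => by simp [toks] at h
  | a :: d :: w, ts, h => by
    have key : ∀ t, (toks w).map (t :: ·) = some ts → (a :: d :: w).length = 2 * ts.length := by
      intro t ht
      simp only [Option.map_eq_some_iff] at ht
      obtain ⟨ts', h1, rfl⟩ := ht
      have := length_of_toks w ts' h1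
      simp [this]; omega
    cases a <;> cases d <;> exact key _ h

/-- **A decodable `y₁` has at most `|y₁| / 6` records.** [folklore] -/
theorem recs_length_le_of_decY1 {y₁ : List Bool} {D : Y1 K} (h : decY1 K y₁ = some D) :
    6 * D.recs.length ≤ y₁.length := by
  simp only [decY1, Option.bind_eq_bind, Option.bind_eq_some_iff, Prod.exists] at h
  obtain ⟨ts, hts, bw, ts₁, hf, rs, hrs, hD⟩ := h
  split at hD
  · simp at hD
  · simp only [Option.some.injEq] at hD
    subst hD
    have e0 := length_of_toks y₁ ts hts
    have e1 := length_le_of_field hf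
    have e2 := length_le_of_recsP (K := K) _ _ _ hrs
    simp only at e2 ⊢
    omega

/-- `|encodeNat n| ≤ n`. [folklore] -/
theorem length_encodeNat_le (n : ℕ) : (encodeNat n).length ≤ n := by
  induction n using Nat.strong_induction_on with
  | _ n ih =>
    rcases Nat.eq_zero_or_pos n with rfl | hn
    · have h0 : encodeNat 0 = [] := rfl
      simp [h0]
    · rw [encodeNat_eq_cons_div_two hn.ne', List.length_cons]
      have := ih (n / 2) (Nat.div_lt_self hn one_lt_two)
      omega

/-- **Descriptors are short**: `|encQ q| ≤ 2 a + 2 a₂ + 2 K + 32` where `a`, `a₂` are the index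
parameters. [folklore] -/
theorem length_encQ_le (q : Q K) :
    (encQ q).length ≤ 2 * (q.code).2.1 + 2 * (q.code).2.2.1 + 2 * K + 32 := by
  have ht : (q.code).1 ≤ 10 := by cases q <;> simp [Q.code]
  have hi : (q.code).2.2.2.1 ≤ K := by
    cases q <;> simp [Q.code]
  have ha := length_encodeNat_le (q.code).2.1
  have hb := length_encodeNat_le (q.code).2.2.1
  unfold encQ
  rw [length_untoks]
  simp only [List.length_append, length_encField, List.length_replicate]
  split <;> simp <;> omega

/-- Parsed entry groups: six tokens. [folklore] -/
theorem length_le_of_egP (ts : List Tok) (g : Eg) (ts' : List Tok) (h : egP ts = some (g, ts')) :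
    ts'.length + 6 ≤ ts.length := by
  simp only [egP, Option.bind_eq_bind, Option.bind_eq_some_iff, Prod.exists] at h
  obtain ⟨w₁, t₁, h₁, w₂, t₂, h₂, w₃, t₃, h₃, w₄, t₄, h₄, w₅, t₅, h₅, w₆, t₆, h₆, h₇⟩ := h
  simp only [Option.some.injEq, Prod.mk.injEq] at h₇
  obtain ⟨-, rfl⟩ := h₇
  have := length_le_of_field h₁; have := length_le_of_field h₂; have := length_le_of_field h₃
  have := length_le_of_field h₄; have := length_le_of_field h₅; have := length_le_of_field h₆
  omega

/-- Parsing groups with a parser consuming at least `d` tokens each. [folklore] -/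
theorem length_le_of_groups' {α : Type} {p : List Tok → Option (α × List Tok)} {d : ℕ}
    (hp : ∀ ts a ts', p ts = some (a, ts') → ts'.length + d ≤ ts.length) :
    ∀ (n : ℕ) (ts : List Tok) (as : List α) (ts' : List Tok), groups p n ts = some (as, ts') →
      ts'.length + n * d ≤ ts.length
  | 0, ts, as, ts', h => by simp [groups] at h; obtain ⟨-, rfl⟩ := h; simp
  | n + 1, ts, as, ts', h => by
    simp only [groups, Option.bind_eq_bind, Option.bind_eq_some_iff, Prod.exists] at h
    obtain ⟨a, t₁, h₁, as', t₂, h₂, h₃⟩ := h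
    simp only [Option.some.injEq, Prod.mk.injEq] at h₃
    obtain ⟨-, rfl⟩ := h₃
    have e1 := hp _ _ _ h₁
    have e2 := length_le_of_groups' hp n t₁ as' t₂ h₂
    rw [Nat.succ_mul]; omega

/-- Parsed entries: `6 K + 2` tokens. [folklore] -/
theorem length_le_of_entryP {ts : List Tok} {en : Entry K} {ts' : List Tok}
    (h : entryP K ts = some (en, ts')) : ts'.length + (6 * K + 2) ≤ ts.length := by
  simp only [entryP, Option.bind_eq_bind, Option.bind_eq_some_iff, Prod.exists] at h
  obtain ⟨uw, t₁, h₁, gs, t₂, h₂, h₃⟩ := h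
  have e₁ := length_le_of_field h₁
  have e₂ := length_le_of_groups' length_le_of_egP K t₁ gs t₂ h₂
  split at h₃
  · simp only [Option.some.injEq, Prod.mk.injEq] at h₃
    obtain ⟨-, rfl⟩ := h₃
    simp only [List.length_cons] at e₂
    rw [Nat.mul_comm] at e₂
    omega
  · simp at h₃

/-- Parsed entry lists: `6 K + 2` tokens per entry. [folklore] -/
theorem length_le_of_entriesP : ∀ (n : ℕ) (ts : List Tok) (es : List (Entry K)),
    entriesP K n ts = some es → (6 * K + 2) * es.length ≤ ts.length
  | n, [], es, h => by
    cases n <;> simp [entriesP] at h <;> subst h <;> simp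
  | 0, _ :: _, es, h => by simp [entriesP] at h
  | n + 1, t :: ts, es, h => by
    simp only [entriesP, Option.bind_eq_bind, Option.bind_eq_some_iff] at h
    obtain ⟨⟨en, ts'⟩, h1, es', h2, h3⟩ := h
    simp only [Option.some.injEq] at h3
    subst h3
    have e1 := length_le_of_entryP h1
    have e2 := length_le_of_entriesP n ts' es' h2
    simp only [List.length_cons] at e1 ⊢
    rw [Nat.mul_succ]; omega

/-- **A decodable `y₃` has at most `|y₃| / 16` entries** (when `K ≥ 1`). [folklore] -/
theorem entries_length_le_of_decY3 (hK : 0 < K) {y₃ : List Bool} {E : Y3 K} (h : decY3 K y₃ = some E) :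
    16 * E.length ≤ y₃.length := by
  simp only [decY3, Option.bind_eq_bind, Option.bind_eq_some_iff] at h
  obtain ⟨ts, hts, hE⟩ := h
  have e0 := length_of_toks y₃ ts hts
  have e1 := length_le_of_entriesP (K := K) _ _ _ hE
  have e2 : 8 * E.length ≤ (6 * K + 2) * E.length := Nat.mul_le_mul_right _ (by omega)
  omega

/-! ### Soundness of the protocol -/

variable {P hP inp out acc}

/-- The label of an in-range address determines it. [folklore] -/
theorem lbl_eq_lbl_iff_of_lt {a p : ℕ} (ha : a < P.length) : FlatN.lbl P p = FlatN.lbl P a ↔ p = a := by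
  unfold FlatN.lbl
  rw [dif_pos ha]
  by_cases hp : p < P.length
  · rw [dif_pos hp]; simp [Fin.ext_iff]
  · rw [dif_neg hp]; simp only [reduceCtorEq, false_iff]; omega

/-- `0 < K` (there is an input register). [folklore] -/
theorem pos_K (inp : Fin K) : 0 < K := by
  rcases Nat.eq_zero_or_pos K with hK | hK
  · subst hK; exact inp.elim0
  · exact hK

/-- A decodable `y₁` has records. [folklore] -/
theorem recs_ne_nil_of_decY1 {y₁ : List Bool} {D : Y1 K} (h : decY1 K y₁ = some D) : D.recs ≠ [] := by
  simp only [decY1, Option.bind_eq_bind, Option.bind_eq_some_iff, Prod.exists] at h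
  obtain ⟨ts, -, bw, ts₁, -, rs, -, hD⟩ := h
  split at hD
  · simp at hD
  · simp only [Option.some.injEq] at hD
    subst hD
    simpa [List.isEmpty_iff] using ‹¬ (rs.isEmpty = true)›

/-- **From the branches to the accepting counter.** If `y₁` decodes to `D` and every branch
`j ≤ N` passes all checks with some well-formed branch data, the flat run from the input
configuration of `x` reaches `acc` (`allChecks_sound`, `protocol_sound`, `FlatN.run_cfgN`).
[cite: PaulEtAl1983, §3] -/
theorem pc_eq_of_branches (hacc : acc < P.length) {x : List Bool} {D : Y1 K} (hne : D.recs ≠ [])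
    (hbranch : ∀ j, j ≤ lastBlock D → ∃ E : Y3 K, AllChecks P hP inp out acc x D j E) :
    (P.step^[lastBlock D * D.b] ⟨0, AStore.single inp x⟩).pc = acc := by
  have hall : ∀ j, j ≤ lastBlock D → ∃ E : Y3 K, ArithAll P hP inp out D ∧ SmallAll x D ∧
      BranchOK (cfg₀ P hP inp out x) D.b (lastBlock D) (claimOf P hP inp out D) (Jset D) j (Aset E)
        (Hof P hP inp out E) ∧
        LightInit (cfg₀ P hP inp out x) (claimOf P hP inp out D) ∧ Final acc D := by
    intro j hj
    obtain ⟨E, hchk⟩ := hbranch j hj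
    exact ⟨E, allChecks_sound hne hchk⟩
  obtain ⟨E₀, -, -, -, hinit, hfin⟩ := hall 0 (Nat.zero_le _)
  have hbr : ∀ j, j ≤ lastBlock D → ∃ (A : Finset ℕ) (Hh : ℕ → Heavy (FlatN.tmN P hP inp out)),
      BranchOK (cfg₀ P hP inp out x) D.b (lastBlock D) (claimOf P hP inp out D) (Jset D) j A Hh := by
    intro j hj
    obtain ⟨E, -, -, hb, -, -⟩ := hall j hj
    exact ⟨_, _, hb⟩
  have hl := (protocol_sound hinit hbr (lastBlock D) le_rfl).1.1
  have hclaim : (claimOf P hP inp out D (lastBlock D)).l = FlatN.lbl P acc := by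
    show FlatN.lbl P (rec D (lastBlock D)).pc = _
    rw [hfin]
  have hrun := FlatN.run_cfgN P hP inp out ⟨0, AStore.single inp x⟩ (lastBlock D * D.b)
  change run (FlatN.tmN P hP inp out) (cfg₀ P hP inp out x) (lastBlock D * D.b) = _ at hrun
  rw [hrun, hclaim] at hl
  exact (lbl_eq_lbl_iff_of_lt hacc).1 hl.symm

/-- **`QSigma 4` over the verifier's language, on the acceptance predicate.** (Proved by
rewriting: eliminating `mem_Vlang_iff` in term mode makes the elaborator compare memberships by
unfolding the decoders, which times out.) [folklore] -/
theorem qSigma_four_accepts_iff {c : ℕ} {x : List Bool} :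
    QSigma 4 c x.length (Vlang P hP inp out acc) x ↔
      ∃ y₁ : List Bool, y₁.length ≤ c * x.length + c ∧ ∀ y₂ : List Bool, y₂.length ≤ c * x.length + c →
        ∃ y₃ : List Bool, y₃.length ≤ c * x.length + c ∧ ∀ y₄ : List Bool, y₄.length ≤ c * x.length + c →
          Accepts P hP inp out acc x y₁ y₂ y₃ y₄ := by
  rw [qSigma_four_iff]
  simp only [mem_Vlang_iff]

/-- **Soundness of the `Σ₄` protocol.** If `x` has a witness for `QSigma 4 c |x| Vlang` (with
`3K + 36 ≤ c` so that every branch index and every relevant descriptor fits the length bound),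
then the flat program run from the input configuration of `x` reaches the counter `acc`: the
decoded `y₁` passes, branch by branch (`y₂ := 1ʲ`) and check by check (`y₄ := encQ q`), all
checks; then `pc_eq_of_branches`. [cite: PaulEtAl1983, §3] -/
theorem sound {c : ℕ} (hc : 4 * K + 64 ≤ c) (hacc : acc < P.length) {x : List Bool}
    (h : QSigma 4 c x.length (Vlang P hP inp out acc) x) :
    ∃ s, (P.step^[s] ⟨0, AStore.single inp x⟩).pc = acc := by
  have hK := pos_K inp
  rw [qSigma_four_accepts_iff] at h
  obtain ⟨y₁, hy₁, H⟩ := h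
  -- `y₁` decodes (take `y₂ = y₄ = ε`)
  rcases hD : decY1 K y₁ with _ | D
  · exfalso
    obtain ⟨y₃, -, h3⟩ := H [] (by simp)
    have h4 := h3 [] (by simp)
    unfold Accepts at h4
    rw [hD, ladder_none] at h4
    exact h4
  have hrecs := recs_length_le_of_decY1 hD
  have hne := recs_ne_nil_of_decY1 hD
  refine ⟨lastBlock D * D.b, pc_eq_of_branches (hP := hP) (out := out) hacc hne fun j hj => ?_⟩
  -- branch `j`: `y₂ := 1ʲ`
  have hjlen : (encJ j).length ≤ c * x.length + c := by
    rw [length_encJ]; unfold lastBlock at hj; omega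
  obtain ⟨y₃, hy₃, hL⟩ := H (encJ j) hjlen
  simp only [Accepts, hD, decJ_encJ] at hL
  -- `y₃` decodes (take `y₄ = ε`)
  rcases hE : decY3 K y₃ with _ | E
  · exfalso
    have h40 := hL [] (by simp)
    rw [hE, ladder_some_some_none] at h40
    exact h40 hj
  have hElen := entries_length_le_of_decY3 hK hE
  refine ⟨E, ?_⟩
  -- a short descriptor is checked
  have short : ∀ q : Q K, 2 * (q.code).2.1 + 2 * (q.code).2.2.1 + 2 * K + 32 ≤ c * x.length + c →
      Check P hP inp out acc x D j E q := by
    intro q hq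
    have h4 := hL (encQ q) ((length_encQ_le q).trans hq)
    rw [hE, decQ_encQ q hK, ladder_some_some_some_some] at h4
    exact h4 hj
  have hN : 6 * (lastBlock D + 1) ≤ c * x.length + c := by
    unfold lastBlock
    have : 0 < D.recs.length := List.length_pos_iff.2 hne
    omega
  have hEl : 16 * E.length ≤ c * x.length + c := hElen.trans hy₃
  have hcc : c ≤ c * x.length + c := Nat.le_add_left _ _
  -- in-range entries are at most `N`
  have hwf : ∀ e, e < E.length → (ent E e).u ≤ lastBlock D :=
    fun e he => short (.wf e) (by simp only [Q.code]; omega) he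
  intro q
  cases q with
  | arith m =>
    by_cases hm : m < D.recs.length
    · exact short _ (by simp only [Q.code]; unfold lastBlock at hN; omega)
    · exact fun hm' => absurd hm' hm
  | lightInit => exact short _ (by simp only [Q.code]; omega)
  | final => exact short _ (by simp only [Q.code]; omega)
  | jInA => exact short _ (by simp only [Q.code]; omega)
  | wf e => exact fun he => hwf e he
  | distinct e e' =>
    intro h1 h2
    exact short (.distinct e e') (by simp only [Q.code]; omega) h1 h2
  | sim e =>
    by_cases he : e < E.length
    · exact short _ (by simp only [Q.code]; omega)
    · exact fun he' => absurd he' he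
  | init e =>
    by_cases he : e < E.length
    · exact short _ (by simp only [Q.code]; omega)
    · exact fun he' => absurd he' he
  | closed e k off =>
    by_cases he : e < E.length
    · exact short _ (by simp only [Q.code]; omega)
    · exact fun he' => absurd he' he
  | dep e k off =>
    by_cases he : e < E.length
    · exact short _ (by simp only [Q.code]; omega)
    · exact fun he' => absurd he' he
  | notouch e k off m =>
    by_cases he : e < E.length
    · by_cases hm : m < (ent E e).u
      · have := hwf e he
        exact short _ (by simp only [Q.code]; omega)
      · exact fun _ _ _ hm' => absurd hm' hm
    · exact fun he' => absurd he' he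

end PPSTSpec

end Literature.Computability.Complexity
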